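import Summits.Ventures.Crystal3D.Bulk.DefectCounting
import Summits.Ventures.Crystal3D.Bulk.LocalTwelve
import Summits.Ventures.Crystal3D.StickySpheres.RadiusOne
import Literature.Geometry.DiscreteGeometry.KissingTwelveLocal
import HarnessLib

/-!
# Bulk crystallization with the sharper constant `K = 702 = 13 · 54` (all-but-one local rule)

HONEST FRAMING. Part of the venture `Summits/Ventures/Crystal3D` (cell `pub-crystal3d`, phase 2;
seat typer-bulk-2; the improvement of the constant is a labelled SIDE DISH of `PLAN.md` R39.2 (iv)).
Observation of the seat lit-4 (cell file `phase2/LIT4-AS-PRINTED.md`): Hales's proof of Theorem 1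
of arXiv:1209.6043 needs, for each non-touching PAIR of neighbours of the centre, only that ONE of
the two is itself touched by twelve balls; so the local twelve-neighbour lemma holds for a
saturated ball ALL BUT AT MOST ONE of whose neighbours are saturated (tree theorem
`Literature.Geometry.DiscreteGeometry.hales2012_localPattern_of_L12_of_allButOne`,
`KissingTwelveLocal.lean`). Consequently a saturated ball with a non-close-packed shell has at
least TWO unsaturated neighbours, the covering count runs with multiplicity two
(`2·#B ≤ 11·#A`), and the defect bound improves from `24(6N - C(x))` to `13(6N - C(x))`, i.e.
from `1296·N^{2/3}` to `702·N^{2/3}` for sticky ground states.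

Content: (any dimension) `two_mul_card_le_mul_card_of_cover_two`; (`ℝ³`)
`two_mul_card_add_le_of_two_unsaturated_neighbors` (`2·#D + 26·C(x) ≤ 156·N`), the all-but-one
predicate form, the ground-state forms (`#D ≤ 702·N^{2/3}`) and the schema
`almostAll_of_localRule_allButOne` — all unconditional counting over the definitions; then the
instance `isClosePackedShell_of_L12_of_allButOne` (seat typer-bulk's `IsClosePackedShell`, from
lit-4's local theorem through the doubling bridge) and
`bulkCrystallization3D_sharp_of_L12_of_kissingConfigCongruent :
flyspeck_L12 → Hales2012_kissingConfigCongruent → BulkCrystallization3D 702`, CONDITIONAL on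
exactly the two computer-assisted named facts of the tree's Hales-2012 formalisation (Lemma 1;
Lemmas 9–10). NO unconditional crystallization theorem is claimed.
-/

noncomputable section

open scoped BigOperators
open Finset

namespace Summit.Ventures.Crystal3D

open Literature.Geometry.DiscreteGeometry

variable {d N : ℕ}

/-! ## Counting with multiplicity two -/

section AnyDimensionTwo

variable (x : Fin N → EuclideanSpace ℝ (Fin d))

/-- **Covering count with multiplicity two.** If every ball of `B` is a contact neighbour of two
DISTINCT balls of `A`, each with at most `k` contacts, then `2·#B ≤ k·#A` (double counting). -/
theorem two_mul_card_le_mul_card_of_cover_two {A B : Finset (Fin N)} {k : ℕ}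
    (hcover : ∀ b ∈ B, ∃ a₁ ∈ A, ∃ a₂ ∈ A, a₁ ≠ a₂ ∧
      b ∈ contactNeighbors x a₁ ∧ b ∈ contactNeighbors x a₂)
    (hdeg : ∀ a ∈ A, coordination x a ≤ k) : 2 * B.card ≤ k * A.card := by
  classical
  calc 2 * B.card = ∑ _b ∈ B, 2 := by simp [mul_comm]
    _ ≤ ∑ b ∈ B, (A.filter fun a => b ∈ contactNeighbors x a).card := by
        refine sum_le_sum fun b hb => ?_
        obtain ⟨a₁, ha₁, a₂, ha₂, hne, hb₁, hb₂⟩ := hcover b hb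
        calc 2 = ({a₁, a₂} : Finset (Fin N)).card := (card_pair hne).symm
          _ ≤ (A.filter fun a => b ∈ contactNeighbors x a).card := by
              refine card_le_card fun a ha => ?_
              rcases mem_insert.1 ha with rfl | ha
              · exact mem_filter.2 ⟨ha₁, hb₁⟩
              · rw [mem_singleton] at ha
                subst ha
                exact mem_filter.2 ⟨ha₂, hb₂⟩
    _ = ∑ b ∈ B, ∑ a ∈ A, if b ∈ contactNeighbors x a then 1 else 0 := by
        simp only [card_filter]
    _ = ∑ a ∈ A, ∑ b ∈ B, if b ∈ contactNeighbors x a then 1 else 0 := sum_comm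
    _ = ∑ a ∈ A, (B.filter fun b => b ∈ contactNeighbors x a).card := by
        simp only [card_filter]
    _ ≤ ∑ a ∈ A, (contactNeighbors x a).card :=
        sum_le_sum fun a _ => card_le_card fun b hb => (mem_filter.1 hb).2
    _ ≤ ∑ _a ∈ A, k := sum_le_sum fun a ha => hdeg a ha
    _ = k * A.card := by simp [mul_comm]

end AnyDimensionTwo

/-! ## Three dimensions: two unsaturated neighbours -/

section ThreeDimensionsTwo

variable {x : Fin N → EuclideanSpace ℝ (Fin 3)}

/-- **The defect count, sharper form.** Let `x` be a packing of `N` unit-diameter balls in `ℝ³`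
and `D` any set of balls such that every saturated ball of `D` has (at least) TWO distinct
unsaturated contact neighbours. Then `2·#D + 26·C(x) ≤ 156·N`, i.e. `#D ≤ 13·(6N - C(x))`. -/
theorem two_mul_card_add_le_of_two_unsaturated_neighbors (hx : IsUnitPacking x)
    {D : Finset (Fin N)}
    (hD : ∀ i ∈ D, coordination x i = 12 → ∃ j ∈ contactNeighbors x i, ∃ j' ∈ contactNeighbors x i,
      j ≠ j' ∧ coordination x j ≠ 12 ∧ coordination x j' ≠ 12) :
    2 * D.card + 26 * numContacts x ≤ 156 * N := by
  classical
  set A : Finset (Fin N) := univ.filter fun i => coordination x i < 12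
  have hA : A.card + 2 * numContacts x ≤ 12 * N := card_coordination_lt_twelve_add_le hx
  have hsplit : D.card ≤ A.card + (D.filter fun i => coordination x i = 12).card := by
    rw [← card_filter_add_card_filter_not (s := D) (fun i => coordination x i = 12),
      add_comm]
    refine Nat.add_le_add_right (card_le_card fun i hi => ?_) _
    rw [mem_filter] at hi
    exact mem_filter.2 ⟨mem_univ _, coordination_lt_twelve_of_ne hx hi.2⟩
  have hB : 2 * (D.filter fun i => coordination x i = 12).card ≤ 11 * A.card := by
    refine two_mul_card_le_mul_card_of_cover_two x (fun b hb => ?_) (fun a ha => ?_)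
    · rw [mem_filter] at hb
      obtain ⟨j, hj, j', hj', hne, hj12, hj12'⟩ := hD b hb.1 hb.2
      exact ⟨j, mem_filter.2 ⟨mem_univ _, coordination_lt_twelve_of_ne hx hj12⟩,
        j', mem_filter.2 ⟨mem_univ _, coordination_lt_twelve_of_ne hx hj12'⟩, hne,
        (mem_contactNeighbors_comm x).1 hj, (mem_contactNeighbors_comm x).1 hj'⟩
    · have := (mem_filter.1 ha).2
      omega
  omega

/-- **Predicate form, all-but-one rule.** If `P` holds at every ball with twelve contacts all of
whose contact neighbours EXCEPT POSSIBLY ONE (`j₀`) have twelve, `2·#{¬P} + 26·C(x) ≤ 156·N`. -/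
theorem two_mul_card_not_add_le_of_localRule_allButOne (hx : IsUnitPacking x) (P : Fin N → Prop)
    [DecidablePred P]
    (hP : ∀ i (j₀ : Fin N), coordination x i = 12 →
      (∀ j ∈ contactNeighbors x i, j ≠ j₀ → coordination x j = 12) → P i) :
    2 * (univ.filter fun i => ¬ P i).card + 26 * numContacts x ≤ 156 * N := by
  refine two_mul_card_add_le_of_two_unsaturated_neighbors hx fun i hi h12 => ?_
  have hnot : ¬ P i := (mem_filter.1 hi).2
  -- a first unsaturated neighbour (exceptional ball `i`), then a second one (exceptional `j`)
  have h1 : ∃ j ∈ contactNeighbors x i, coordination x j ≠ 12 := by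
    by_contra h
    exact hnot (hP i i h12 fun j hj _ => by by_contra hj12; exact h ⟨j, hj, hj12⟩)
  obtain ⟨j, hj, hj12⟩ := h1
  have h2 : ∃ j' ∈ contactNeighbors x i, j' ≠ j ∧ coordination x j' ≠ 12 := by
    by_contra h
    exact hnot (hP i j h12 fun j' hj' hne => by by_contra hj12'; exact h ⟨j', hj', hne, hj12'⟩)
  obtain ⟨j', hj', hne, hj12'⟩ := h2
  exact ⟨j, hj, j', hj', hne.symm, hj12, hj12'⟩

/-- **The reduction, sharper set form**: in a sticky ground state, a set `D` each of whose
saturated members has two distinct unsaturated contact neighbours has `#D ≤ 702·N^{2/3}`. -/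
theorem IsStickyGroundState.card_le_of_two_unsaturated_neighbors (hx : IsStickyGroundState x)
    {D : Finset (Fin N)}
    (hD : ∀ i ∈ D, coordination x i = 12 → ∃ j ∈ contactNeighbors x i, ∃ j' ∈ contactNeighbors x i,
      j ≠ j' ∧ coordination x j ≠ 12 ∧ coordination x j' ≠ 12) :
    (D.card : ℝ) ≤ 702 * (N : ℝ) ^ ((2 : ℝ) / 3) := by
  have h1 : 2 * (D.card : ℝ) + 26 * numContacts x ≤ 156 * N := by
    exact_mod_cast two_mul_card_add_le_of_two_unsaturated_neighbors hx.1 hD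
  have h2 := hx.six_mul_sub_numContacts_le
  linarith

/-- **The reduction, sharper predicate form**: in a sticky ground state, a property forced at
every saturated ball with at most one unsaturated neighbour fails for `≤ 702·N^{2/3}` balls. -/
theorem IsStickyGroundState.card_not_le_of_localRule_allButOne (hx : IsStickyGroundState x)
    (P : Fin N → Prop) [DecidablePred P]
    (hP : ∀ i (j₀ : Fin N), coordination x i = 12 →
      (∀ j ∈ contactNeighbors x i, j ≠ j₀ → coordination x j = 12) → P i) :
    ((univ.filter fun i => ¬ P i).card : ℝ) ≤ 702 * (N : ℝ) ^ ((2 : ℝ) / 3) := by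
  have h1 : 2 * ((univ.filter fun i => ¬ P i).card : ℝ) + 26 * numContacts x ≤ 156 * N := by
    exact_mod_cast two_mul_card_not_add_le_of_localRule_allButOne hx.1 P hP
  have h2 := hx.six_mul_sub_numContacts_le
  linarith

/-- **Reduction schema, all-but-one rule, `K = 702`.** If in every finite unit packing of `ℝ³` a
ball with twelve contacts, all of whose contact neighbours except possibly one have twelve
contacts, is good, then in every sticky ground state all but `≤ 702·N^{2/3}` balls are good. -/
theorem almostAll_of_localRule_allButOne
    (Good : ∀ {M : ℕ}, (Fin M → EuclideanSpace ℝ (Fin 3)) → Fin M → Prop)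
    (hrule : ∀ {M : ℕ} (y : Fin M → EuclideanSpace ℝ (Fin 3)), IsUnitPacking y →
      ∀ i (j₀ : Fin M), coordination y i = 12 →
        (∀ j ∈ contactNeighbors y i, j ≠ j₀ → coordination y j = 12) → Good y i)
    (hx : IsStickyGroundState x) [DecidablePred (Good x)] :
    ((univ.filter fun i => ¬ Good x i).card : ℝ) ≤ 702 * (N : ℝ) ^ ((2 : ℝ) / 3) :=
  hx.card_not_le_of_localRule_allButOne (Good x) (hrule x hx.1)

end ThreeDimensionsTwo

/-! ## The all-but-one local rule from Hales's two inputs, and `K = 702` -/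

section Instance

variable {x : Fin N → EuclideanSpace ℝ (Fin 3)}

/-- Bridge (local copy; the named version lives in `Bulk/GapReduction.lean`): the seat
typer-bulk's `contactShell x i` is the Literature's kissing shell of `2·xᵢ` in `2·range x`. -/
private theorem kissingShell_range_eq_contactShell (x : Fin N → EuclideanSpace ℝ (Fin 3))
    (i : Fin N) :
    kissingShell (Set.range fun j => (2 : ℝ) • x j) ((2 : ℝ) • x i) = contactShell x i := by
  ext z
  simp only [mem_kissingShell_iff, Set.mem_range, mem_contactShell, mem_contactNeighbors]
  constructor
  · rintro ⟨⟨j, hj⟩, hz⟩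
    have hzj : z = (2 : ℝ) • (x j - x i) := by rw [smul_sub, hj]; abel
    refine ⟨j, ⟨?_, ?_⟩, hzj.symm⟩
    · rintro rfl
      rw [sub_self, smul_zero] at hzj
      rw [hzj, norm_zero] at hz
      norm_num at hz
    · rw [hzj, norm_smul, Real.norm_two, ← dist_eq_norm, dist_comm] at hz
      linarith
  · rintro ⟨j, ⟨-, hd⟩, rfl⟩
    refine ⟨⟨j, by rw [smul_sub]; abel⟩, ?_⟩
    rw [norm_smul, Real.norm_two, ← dist_eq_norm, dist_comm, hd]
    norm_num

/-- **`L12(1)`, all-but-one form, in the cell's vocabulary** (conditional on Hales's two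
computer-assisted inputs): in a packing of unit-diameter balls in `ℝ³`, a ball `i` with twelve
contacts all of whose contact neighbours other than possibly `j₀` have twelve contacts has a
close-packed (FCC or HCP) first shell. From lit-4's `hales2012_localPattern_of_L12_of_allButOne`
through the doubling `x ↦ 2x`. -/
theorem isClosePackedShell_of_L12_of_allButOne (hL12 : flyspeck_L12)
    (hcl : Hales2012_kissingConfigCongruent) (hx : IsUnitPacking x) {i : Fin N} (j₀ : Fin N)
    (hi : coordination x i = 12)
    (hnb : ∀ j ∈ contactNeighbors x i, j ≠ j₀ → coordination x j = 12) :
    IsClosePackedShell x i := by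
  have hV := ((isUnitPacking_iff_two_smul x).1 hx).2
  rw [IsClosePackedShell, ← kissingShell_range_eq_contactShell]
  refine hales2012_localPattern_of_L12_of_allButOne hL12 hcl hV ?_ ((2 : ℝ) • x j₀)
    fun w hw hd hw₀ => ?_
  · rw [kissingShell_range_eq_contactShell, ncard_contactShell hx, hi]
  · obtain ⟨j, rfl⟩ := hw
    have hj : j ∈ contactNeighbors x i := by
      refine (mem_contactNeighbors x).2 ⟨?_, ?_⟩
      · rintro rfl
        rw [dist_self] at hd
        norm_num at hd
      · rw [dist_comm, dist_two_smul] at hd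
        linarith
    have hjj₀ : j ≠ j₀ := fun h => hw₀ (by rw [h])
    rw [kissingShell_range_eq_contactShell, ncard_contactShell hx, hnb j hj hjj₀]

/-- Under the all-but-one rule, a saturated ball with a NON-close-packed shell has two distinct
unsaturated contact neighbours. -/
theorem two_unsaturated_of_not_isClosePackedShell (hL12 : flyspeck_L12)
    (hcl : Hales2012_kissingConfigCongruent) (hx : IsUnitPacking x) {i : Fin N}
    (hi : coordination x i = 12) (hnot : ¬ IsClosePackedShell x i) :
    ∃ j ∈ contactNeighbors x i, ∃ j' ∈ contactNeighbors x i,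
      j ≠ j' ∧ coordination x j ≠ 12 ∧ coordination x j' ≠ 12 := by
  have h1 : ∃ j ∈ contactNeighbors x i, coordination x j ≠ 12 := by
    by_contra h
    exact hnot (isClosePackedShell_of_L12_of_allButOne hL12 hcl hx i hi
      fun j hj _ => by by_contra hj12; exact h ⟨j, hj, hj12⟩)
  obtain ⟨j, hj, hj12⟩ := h1
  have h2 : ∃ j' ∈ contactNeighbors x i, j' ≠ j ∧ coordination x j' ≠ 12 := by
    by_contra h
    exact hnot (isClosePackedShell_of_L12_of_allButOne hL12 hcl hx j hi
      fun j' hj' hne => by by_contra hj12'; exact h ⟨j', hj', hne, hj12'⟩)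
  obtain ⟨j', hj', hne, hj12'⟩ := h2
  exact ⟨j, hj, j', hj', hne.symm, hj12, hj12'⟩

/-- **Bulk crystallization with `K = 702`** (conditional on exactly the two computer-assisted
named facts `flyspeck_L12` and `Hales2012_kissingConfigCongruent` of the tree's Hales-2012
formalisation): in every sticky ground state of `N` hard unit spheres in `ℝ³` all but at most
`702·N^{2/3}` balls have an FCC or HCP first coordination shell. -/
theorem bulkCrystallization3D_sharp_of_L12_of_kissingConfigCongruent (hL12 : flyspeck_L12)
    (hcl : Hales2012_kissingConfigCongruent) : BulkCrystallization3D 702 := fun _N _x hx =>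
  hx.card_le_of_two_unsaturated_neighbors fun _i hi h12 =>
    two_unsaturated_of_not_isClosePackedShell hL12 hcl hx.1 h12 (mem_nonClosePacked.1 hi)

end Instance

end Summit.Ventures.Crystal3D

end
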